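import Mathlib
import HarnessLib
import Summits.HubbardSuperconductivity.HubbardSuperconductivity.Theorems.KLProgrammeFourLegCommonTimeL1

/-!
# Route `KLProgramme` — ENGINE (stmt-HubbardSuperconductivity-20437 `KLRegimeEngineV17F2`): CYCLIC ABEL SUMMATION on `ZMod N`
# and the second-difference bound `‖1 - ψ(j)‖² · |ǧ(-j)| ≤ ‖Δ²g‖₁`, with `‖1 - ψ(j)‖ = 2|sin(π k/N)| ≥ 4|k|/N` (`k = valMinAbs j`)

Cell `gate-hubbard-kl`, seat p1b g23 (registrant lineage), def-free helper `--supports stmt-HubbardSuperconductivity-20437`;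
companion of ✓ `KLProgrammeFourLegCommonTimeL1` (`Θ ≤ A₁A₂A₃A₄`).  This file is the ANALYTIC half of the k3c2 lineage's post-verdict
item (i) (HOME/hubbard-kl-k3c2-p2/g34/CUT-CURRENCY-DIGITS.md rev 2: «bound `A` β- and M-uniformly by two discrete summations by
parts on the Matsubara lattice»), again in abstract `ZMod N` form:
* `klct_cyclicAbel` — on the cyclic group summation by parts is EXACT, with no boundary term:
  `(1 - ψ j) · Σ_n g n ψ(n j) = Σ_n (g n - g (n-1)) ψ(n j)`; iterated, `klct_cyclicAbel₂`:
  `(1 - ψ j)² · Σ_n g n ψ(n j) = Σ_n (g n - 2 g(n-1) + g(n-2)) ψ(n j)`;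
* `klct_norm_dft_le_sum_norm` — `|ǧ(k)| ≤ ‖g‖₁`; `klct_normSq_oneSub_mul_norm_dft_le` — `‖1 - ψ j‖² · |ǧ(-j)| ≤ ‖Δ² g‖₁`;
* `klct_norm_one_sub_stdAddChar` — `‖1 - ψ j‖ = 2 |sin(π k / N)|`, `k = ZMod.valMinAbs j ∈ (-N/2, N/2]`;
* `klct_jordan_one_sub_stdAddChar` — `4|k|/N ≤ ‖1 - ψ j‖` (Jordan's inequality `sin x ≥ (2/π) x` on `[0, π/2]`).
Hence `|ǧ(-j)| ≤ min(‖g‖₁, N² ‖Δ²g‖₁ / (16 k²))` for `k ≠ 0`, which sums over `j` to an `N`-uniform bound on `A = N⁻¹ Σ_j |ǧ(j)|`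
once `‖g‖₁ ≍ w` and `‖Δ²g‖₁ ≍ 1/w` (a `C²` cut-off of width `w`) — the instantiating seat's arithmetic.  Pure finite-sum algebra and
one-variable calculus from Mathlib; no definition, no model estimate; nothing here asserts any registered row, K3, U₀, the window, a
margin or superconductivity in the Hubbard model.
References: BGM 2006 §2.3 (2.17) [cite: BenfattoGiulianiMastropietro2006]; summation by parts / Jordan's inequality [folklore].
-/

noncomputable section

namespace Summit.HubbardSuperconductivity.HubbardSuperconductivity.Theorems.KLRegimeSplit

set_option linter.dupNamespace false -- summit = problem name (single-conjunct summit), D-0017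

open Finset Real

variable {N : ℕ} [NeZero N]

/-- Shift re-indexing against a phase: `Σ_n g(n-1) ψ(n j) = ψ(j) · Σ_n g n ψ(n j)`. [folklore] -/
theorem klct_sum_shift_mul_stdAddChar (g : ZMod N → ℂ) (j : ZMod N) :
    ∑ n : ZMod N, g (n - 1) * ZMod.stdAddChar (n * j) =
      ZMod.stdAddChar j * ∑ n : ZMod N, g n * ZMod.stdAddChar (n * j) := by
  rw [Finset.mul_sum]
  have h := (Equiv.subRight (1 : ZMod N)).sum_comp (fun m => g m * ZMod.stdAddChar ((m + 1) * j))
  simp only [Equiv.subRight_apply, sub_add_cancel] at h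
  rw [h]
  refine Finset.sum_congr rfl fun m _ => ?_
  rw [add_mul, one_mul, AddChar.map_add_eq_mul]
  ring

/-- **CYCLIC ABEL SUMMATION** (exact on `ZMod N`, no boundary term):
`(1 - ψ j) · Σ_n g n ψ(n j) = Σ_n (g n - g (n-1)) ψ(n j)`. [folklore] -/
theorem klct_cyclicAbel (g : ZMod N → ℂ) (j : ZMod N) :
    (1 - ZMod.stdAddChar j) * ∑ n : ZMod N, g n * ZMod.stdAddChar (n * j) =
      ∑ n : ZMod N, (g n - g (n - 1)) * ZMod.stdAddChar (n * j) := by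
  simp_rw [sub_mul]
  rw [Finset.sum_sub_distrib, klct_sum_shift_mul_stdAddChar, one_mul]

/-- **Cyclic Abel summation, iterated**: `(1 - ψ j)² · Σ_n g n ψ(n j) = Σ_n (g n - 2 g(n-1) + g(n-2)) ψ(n j)`. [folklore] -/
theorem klct_cyclicAbel₂ (g : ZMod N → ℂ) (j : ZMod N) :
    (1 - ZMod.stdAddChar j) ^ 2 * ∑ n : ZMod N, g n * ZMod.stdAddChar (n * j) =
      ∑ n : ZMod N, (g n - 2 * g (n - 1) + g (n - 2)) * ZMod.stdAddChar (n * j) := by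
  rw [sq, mul_assoc, klct_cyclicAbel, klct_cyclicAbel (fun n => g n - g (n - 1))]
  refine Finset.sum_congr rfl fun n _ => ?_
  simp only [sub_sub, one_add_one_eq_two]
  ring

/-- The trivial bound `|ǧ(k)| ≤ ‖g‖₁` (`ǧ = ZMod.dft g`, `|ψ| = 1`). [folklore] -/
theorem klct_norm_dft_le_sum_norm (g : ZMod N → ℂ) (k : ZMod N) :
    ‖ZMod.dft g k‖ ≤ ∑ n : ZMod N, ‖g n‖ := by
  rw [ZMod.dft_apply]
  refine (norm_sum_le _ _).trans (le_of_eq (Finset.sum_congr rfl fun n _ => ?_))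
  rw [norm_smul, ZMod.stdAddChar_apply, Circle.norm_coe, one_mul]

/-- **The second-difference bound**: `‖1 - ψ j‖² · |ǧ(-j)| ≤ Σ_n |g n - 2 g(n-1) + g(n-2)|`. [folklore] -/
theorem klct_normSq_oneSub_mul_norm_dft_le (g : ZMod N → ℂ) (j : ZMod N) :
    ‖1 - (ZMod.stdAddChar j : ℂ)‖ ^ 2 * ‖ZMod.dft g (-j)‖ ≤
      ∑ n : ZMod N, ‖g n - 2 * g (n - 1) + g (n - 2)‖ := by
  rw [← klct_sum_mul_stdAddChar_eq_dft, ← norm_pow, ← norm_mul, klct_cyclicAbel₂]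
  refine (norm_sum_le _ _).trans (le_of_eq (Finset.sum_congr rfl fun n _ => ?_))
  rw [norm_mul, ZMod.stdAddChar_apply, Circle.norm_coe, mul_one]

/-- `‖1 - ψ(j)‖ = 2 |sin(π k / N)|` with `k = ZMod.valMinAbs j` the representative in `(-N/2, N/2]`. [folklore] -/
theorem klct_norm_one_sub_stdAddChar (j : ZMod N) :
    ‖1 - (ZMod.stdAddChar j : ℂ)‖ = 2 * |Real.sin (π * (j.valMinAbs : ℝ) / N)| := by
  have hj : (ZMod.stdAddChar j : ℂ) = Complex.exp (Complex.I * ((2 * π * (j.valMinAbs : ℝ) / N : ℝ) : ℂ)) := by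
    have h0 : (ZMod.stdAddChar j : ℂ) = ZMod.stdAddChar ((j.valMinAbs : ℤ) : ZMod N) := by
      rw [ZMod.coe_valMinAbs]
    rw [h0, ZMod.stdAddChar_coe]
    congr 1
    push_cast
    ring
  rw [hj, norm_sub_rev, Complex.norm_exp_I_mul_ofReal_sub_one, Real.norm_eq_abs, abs_mul, abs_two]
  congr 2
  ring

/-- **Jordan's inequality for the character**: `4 |k| / N ≤ ‖1 - ψ(j)‖`, `k = ZMod.valMinAbs j` (since `|π k/N| ≤ π/2` and
`sin x ≥ (2/π) x` on `[0, π/2]`). [folklore] -/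
theorem klct_jordan_one_sub_stdAddChar (j : ZMod N) :
    4 * |(j.valMinAbs : ℝ)| / N ≤ ‖1 - (ZMod.stdAddChar j : ℂ)‖ := by
  rw [klct_norm_one_sub_stdAddChar]
  have hN : (0 : ℝ) < N := Nat.cast_pos.mpr (NeZero.pos N)
  have hmem := j.valMinAbs_mem_Ioc
  have hlo : (-(N : ℝ)) < (j.valMinAbs : ℝ) * 2 := by exact_mod_cast hmem.1
  have hhi : (j.valMinAbs : ℝ) * 2 ≤ N := by exact_mod_cast hmem.2
  have hk : |(j.valMinAbs : ℝ)| ≤ N / 2 := by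
    rw [abs_le]
    constructor <;> linarith
  -- `x := π |k| / N ∈ [0, π/2]`
  have hx0 : 0 ≤ π * |(j.valMinAbs : ℝ)| / N := by positivity
  have hx1 : π * |(j.valMinAbs : ℝ)| / N ≤ π / 2 := by
    rw [div_le_div_iff₀ hN two_pos]
    have := mul_le_mul_of_nonneg_left hk pi_pos.le
    nlinarith
  have hsin : 2 / π * (π * |(j.valMinAbs : ℝ)| / N) ≤ Real.sin (π * |(j.valMinAbs : ℝ)| / N) :=
    Real.mul_le_sin hx0 hx1
  -- `|sin(π k/N)| = sin(π |k| / N)`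
  have habs : |Real.sin (π * (j.valMinAbs : ℝ) / N)| = Real.sin (π * |(j.valMinAbs : ℝ)| / N) := by
    have hsn : 0 ≤ Real.sin (π * |(j.valMinAbs : ℝ)| / N) :=
      Real.sin_nonneg_of_nonneg_of_le_pi hx0 (hx1.trans (by linarith [pi_pos]))
    rcases abs_choice (j.valMinAbs : ℝ) with h | h
    · rw [h] at hsn ⊢
      exact abs_of_nonneg hsn
    · have : π * (j.valMinAbs : ℝ) / N = -(π * |(j.valMinAbs : ℝ)| / N) := by rw [h]; ring
      rw [this, Real.sin_neg, abs_neg, abs_of_nonneg hsn]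
  rw [habs]
  calc 4 * |(j.valMinAbs : ℝ)| / N = 2 * (2 / π * (π * |(j.valMinAbs : ℝ)| / N)) := by
        field_simp
        ring
    _ ≤ 2 * Real.sin (π * |(j.valMinAbs : ℝ)| / N) := by gcongr

/-- **Pointwise decay of the transform off the zero mode**: for `j ≠ 0` with `k = ZMod.valMinAbs j`,
`|ǧ(-j)| ≤ N² / (16 k²) · Σ_n |g n - 2 g(n-1) + g(n-2)|` (second-difference bound ÷ Jordan's inequality squared).
Together with `klct_norm_dft_le_sum_norm` this is the two-regime bound `|ǧ| ≤ min(‖g‖₁, N²‖Δ²g‖₁/(16k²))` whose `j`-average is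
`N`-uniform for a `C²` cut-off (`Σ_{k>J} k⁻² ≤ 2/(J+1)`: Mathlib `sum_Ioo_inv_sq_le`). [folklore] -/
theorem klct_norm_dft_le_secondDiff_div_sq (g : ZMod N → ℂ) (j : ZMod N) (hj : j ≠ 0) :
    ‖ZMod.dft g (-j)‖ ≤
      (N : ℝ) ^ 2 / (16 * (j.valMinAbs : ℝ) ^ 2) * ∑ n : ZMod N, ‖g n - 2 * g (n - 1) + g (n - 2)‖ := by
  have hk : (j.valMinAbs : ℝ) ≠ 0 := by
    exact_mod_cast fun h => hj ((ZMod.valMinAbs_eq_zero j).mp h)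
  have hN : (0 : ℝ) < N := Nat.cast_pos.mpr (NeZero.pos N)
  have hpos : 0 < 4 * |(j.valMinAbs : ℝ)| / N := by positivity
  have hlow : (4 * |(j.valMinAbs : ℝ)| / N) ^ 2 ≤ ‖1 - (ZMod.stdAddChar j : ℂ)‖ ^ 2 :=
    pow_le_pow_left₀ hpos.le (klct_jordan_one_sub_stdAddChar j) 2
  have hc : 0 < ‖1 - (ZMod.stdAddChar j : ℂ)‖ ^ 2 := lt_of_lt_of_le (pow_pos hpos 2) hlow
  have hmain := klct_normSq_oneSub_mul_norm_dft_le g j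
  have hD : 0 ≤ ∑ n : ZMod N, ‖g n - 2 * g (n - 1) + g (n - 2)‖ := Finset.sum_nonneg fun n _ => norm_nonneg _
  calc ‖ZMod.dft g (-j)‖
      ≤ (∑ n : ZMod N, ‖g n - 2 * g (n - 1) + g (n - 2)‖) / ‖1 - (ZMod.stdAddChar j : ℂ)‖ ^ 2 := by
        rw [le_div_iff₀ hc, mul_comm]
        exact hmain
    _ ≤ (∑ n : ZMod N, ‖g n - 2 * g (n - 1) + g (n - 2)‖) / (4 * |(j.valMinAbs : ℝ)| / N) ^ 2 :=
        div_le_div_of_nonneg_left hD (pow_pos hpos 2) hlow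
    _ = (N : ℝ) ^ 2 / (16 * (j.valMinAbs : ℝ) ^ 2) * ∑ n : ZMod N, ‖g n - 2 * g (n - 1) + g (n - 2)‖ := by
        rw [div_pow, mul_pow, sq_abs]
        field_simp
        ring

end Summit.HubbardSuperconductivity.HubbardSuperconductivity.Theorems.KLRegimeSplit

end
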